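import Mathlib
import Summits.KontsevichZagierPeriods.Zeta5Search.WellPoisedFaceZeta57
import Summits.KontsevichZagierPeriods.Zeta5Search.WellPoisedFaceAliveBricks
import Literature.NumberTheory.Irrationality.Hata1992.PrimeWindows
import Literature.NumberTheory.DiophantineApproximation.DilogLandenLinearIndependenceRates
import HarnessLib.Audit
import HarnessLib

/-!
# The numerator-free face for `q ≤ 9` (windows `{ζ(5)}`, `{ζ(5), ζ(7)}`): prime-number-theorem bookkeeping
# in the kernel and GROWTH of Lemma 19's normalised forms given the decay floor
# — cell `pub-zeta5`, class `odd` (gen 6), target T4 (structural no-go serving T2)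

HONEST FRAMING: systematic search; no irrationality claim unless certified.  This file proves a NEGATIVE
(the integer-normalised forms of a printed construction cannot tend to zero on a whole face), not a candidate.

`WellPoisedFaceZeta57` + `WellPoisedFaceAliveBricks` (tree) prove the face no-go at the level of RATES: for a
direction `(η₀; 0,0,0, a ≤ mid₁ … mid_M ≤ d)`, `2d < η₀`, of Zudilin's `r = 3` box with `q = M + 5` parameters
[Zudilin2004, §8, (8.6)–(8.9), Lemma 19, Proposition 5], `C₀ < δ − φ` for every `φ ≤ φ⁺` (`FaceDirM.face_noGo`),
`φ⁺ = Σ_{alive j}(η₀ − 2η_j)` coming from the integer inequality `Φ ≤ ∏_{j : h_j < h_q}(h₀ − 2h_j)#` (`PhiQ_face_le`)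
"by `θ(x) ∼ x` (PNT bookkeeping on paper)".  Here that paper step is done in the kernel, for ANY number `M + 2` of
tail bricks, along the integral rays `h₀ = η₀n + 2`, `h₁ = h₂ = h₃ = 1`, `h_{3+j} = η_{3+j}n + 1` (`IntFaceDir`):
* `facePhi` = (8.9) VERBATIM at the ray (`PhiQ`, `k_lo = h₄`, primes `√h₀ < p ≤ M_{q−3}`, `M_j` = the tree's `mLast`;
  dictionary `faceMZ_eq : M_j = n·μ_j`, `μ_j = max(η₀ − 2η₄, η₀ − η_{3+j})`); `faceD = D_{M₁}³·∏_{j≥2} D_{M_j}`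
  (`D_N = lcm(1..N) = Nat.lcmUpto N`); `faceLambda F n = Λ_n(F) := D(n)·Φ(h_n)⁻¹·F n`.
* `log_facePhi_le : log Φ(h_n) ≤ Σ_{j : η_j < η_q} θ((η₀ − 2η_j)n)` (every `n ≥ 1`; `log N# = θ(N)`, Mathlib) and
  **`log_facePhi_eventually_le : ∀ ε > 0, ∀ᶠ n, log Φ(h_n) ≤ (φ⁺_ℕ + ε)n`**, `φ⁺_ℕ = Σ_{j : η_j < η_q}(η₀ − 2η_j) ≤ φ⁺`
  (`phiPlusN_le`): `φ_true ≤ φ⁺` is now a KERNEL statement — the PNT `θ(cn)/n → c` is the tree theorem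
  `Literature.NumberTheory.Irrationality.Hata1992.tendsto_theta_mul_div` (from `chebyshevTheta_isEquivalent`).
* `tendsto_log_faceD_div : (log D(n))/n → δ = FaceDirM.delta` (PNT for `ψ`: the tree's
  `ViolaZudilin.tendsto_log_lcmUpto_mul_div`, `(log D_{cn})/n → c`, from Mathlib's `Chebyshev.psi_eq_log_lcmUpto`).
* ASSEMBLY `faceLambda_eventually_ge`, **`faceLambda_tendsto_atTop`**: for ANY real sequence `F` with the decay floor
  `∀ ε > 0, ∀ᶠ n, exp(−(C₀ + ε)n) ≤ |F n|` (`C₀ = FaceDirM.C0 = Σ blockRate`): `∀ ε > 0, ∀ᶠ n, exp((δ − φ⁺ − C₀ − ε)n)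
  ≤ |Λ_n(F)|`, and for `M ≤ 4` (`q ≤ 9`) `|Λ_n(F)| → +∞` (`face_gap`: `δ − φ⁺ − C₀ ≥ (2 − log 2 − M log(4/3))η₀
  > 0`).  With `F n = F(h_n)` of (8.6) this is the face theorem of
  families/odd/FAMILY.md §5.11 END TO END modulo exactly ONE analytic input, the boundary lemma
  `(1/n) log F(h_n) → −C₀` (lower half only).  For `q = 7` (`M = 2`) that input is fam-vwp's kernel programme
  (namespace `WellPoisedFaceRate`: `WellPoisedFaceBoundaryRate`, `…Convexity` in the tree, `…Sandwich`, `…Growth`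
  staged — the `q = 7` face with the cruder envelope `3m₄` and NO hypothesis); for `q = 8, 9` it is the [Zudilin2004,
  Lemma 20]-type asymptotics on the face, PRINTED, entering only as the hypothesis `hF` — no printed fact is an axiom.
## What is NOT proved here
The boundary lemma for `M ≠ 2` (hypothesis `hF`); Lemma 19's membership `Λ_n ∈ ℤ + ℤζ(5) + ℤζ(7) + ⋯` (PRINTED for
odd `q`; the class-`odd` parity variant for `q = 8`, FAMILY.md §1) — the MEANING of `Λ_n`, used nowhere; anything off
the face.  Forms that grow prove nothing about `ζ(5)`, `ζ(7)`: this is a no-go.  Standard axioms only.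
-/

noncomputable section

open Real Finset Filter Topology

namespace Summit.KontsevichZagierPeriods.Zeta5Search

namespace WellPoisedFace

open Literature.NumberTheory.DiophantineApproximation.ViolaZudilin (tendsto_log_lcmUpto_mul_div)

/-! ### 1. Integral face directions and the ray `h₀ = η₀n + 2`, `h₁ = h₂ = h₃ = 1`, `h_{3+j} = η_{3+j} n + 1` -/

/-- An INTEGRAL direction on the numerator-free face of the `r = 3`, `q = M + 5` box: `η₀` and the `M + 2` tails
`tail = (η₄, η₅, …, η_q)` listed with the smallest first and the largest last (the middle ones in any order),
`2·η_q < η₀` ((8.1)/(8.13): `h_q < h₀/2`). -/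
structure IntFaceDir (M : ℕ) where
  /-- `η₀` -/
  η₀ : ℕ
  /-- the tails `(η₄, …, η_q)`: `tail 0 = η₄` smallest, `tail (last) = η_q` largest -/
  tail : Fin (M + 2) → ℕ
  /-- `η₄` is the smallest tail -/
  hlo : ∀ j, tail 0 ≤ tail j
  /-- `η_q` is the largest tail -/
  hhi : ∀ j, tail j ≤ tail (Fin.last (M + 1))
  /-- `2η_q < η₀` -/
  hd : 2 * tail (Fin.last (M + 1)) < η₀

namespace IntFaceDir

variable {M : ℕ} (E : IntFaceDir M)

/-- `a = η₄`, the smallest tail. -/ def a : ℕ := E.tail 0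
/-- `d = η_q`, the largest tail. -/ def d : ℕ := E.tail (Fin.last (M + 1))
/-- the middle tails `η₅, …, η_{q−1}`. -/ def mid (j : Fin M) : ℕ := E.tail j.succ.castSucc

/-- `2η_j ≤ η₀` for every tail. -/
lemma two_tail_le (j : Fin (M + 2)) : 2 * E.tail j ≤ E.η₀ := by have h1 := E.hhi j; have h2 := E.hd; omega
/-- `η_j < η₀` for every tail. -/
lemma tail_lt_η₀ (j : Fin (M + 2)) : E.tail j < E.η₀ := by have h1 := E.hhi j; have h2 := E.hd; omega
/-- `η₄ + η_q ≤ η₀`. -/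
lemma a_add_d_le : E.tail 0 + E.tail (Fin.last (M + 1)) ≤ E.η₀ := by
  have h1 := E.hlo (Fin.last (M + 1)); have h2 := E.hd; omega

/-- The same direction read as a real `FaceDirM` (the structure of `WellPoisedFaceZeta57`). -/
def real : FaceDirM M where
  η₀ := E.η₀
  a := E.a
  mid j := E.mid j
  d := E.d
  ha := Nat.cast_nonneg _
  hlo j := Nat.cast_le.mpr (E.hlo _)
  hhi j := Nat.cast_le.mpr (E.hhi _)
  had := Nat.cast_le.mpr (E.hlo _)
  hd := by show (2 : ℝ) * (E.tail (Fin.last (M + 1)) : ℝ) < E.η₀; exact_mod_cast E.hd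

/-- `h₀ = η₀ n + 2` (an integer, the argument type of `PhiQ`, `mLast`). -/
def h0 (n : ℕ) : ℤ := ((E.η₀ * n + 2 : ℕ) : ℤ)

/-- `h_{3+j} = η_{3+j} n + 1`. -/
def hT (n : ℕ) (j : Fin (M + 2)) : ℤ := ((E.tail j * n + 1 : ℕ) : ℤ)

/-- The unscaled Lemma-19 exponents `μ(x) = max(η₀ − 2η₄, η₀ − x)` [Zudilin2004, p. 270: `m_j/n`]. -/
def mu (x : ℕ) : ℕ := max (E.η₀ - 2 * E.a) (E.η₀ - x)

/-- `μ(x) ≥ η₀ − 2η₄ > 0`. -/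
lemma mu_pos (x : ℕ) : 0 < E.mu x := by
  have h1 := E.hlo (Fin.last (M + 1)); have h2 := E.hd; exact lt_max_iff.2 (Or.inl (by unfold a; omega))

/-- Zudilin's `M_j = max{h₃ − 1, h₀ − 2h₄, h₀ − h₁ − h_{3+j}}` VERBATIM at the ray (the tree's `mLast`). -/
def faceMZ (n : ℕ) (j : Fin (M + 2)) : ℤ := mLast (E.h0 n) 1 1 (E.hT n 0) (E.hT n j)

/-- DICTIONARY (kernel): `M_j = μ(η_{3+j}) · n` exactly. -/
theorem faceMZ_eq (n : ℕ) (j : Fin (M + 2)) : E.faceMZ n j = ((E.mu (E.tail j) * n : ℕ) : ℤ) := by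
  have h2a : 2 * E.tail 0 ≤ E.η₀ := E.two_tail_le 0
  have hj : E.tail j ≤ E.η₀ := (E.tail_lt_η₀ j).le
  unfold faceMZ mLast h0 hT mu a
  rw [Nat.cast_mul, Nat.cast_max, Nat.cast_sub h2a, Nat.cast_sub hj,
    max_mul_of_nonneg _ _ (by positivity : (0 : ℤ) ≤ n)]
  push_cast
  have e1 : ((E.η₀ : ℤ) * n + 2) - 2 * ((E.tail 0 : ℤ) * n + 1) = ((E.η₀ : ℤ) - 2 * (E.tail 0 : ℤ)) * (n : ℤ) := by
    ring
  have e2 : ((E.η₀ : ℤ) * n + 2) - 1 - ((E.tail j : ℤ) * n + 1) = ((E.η₀ : ℤ) - (E.tail j : ℤ)) * (n : ℤ) := by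
    ring
  have hnn : (0 : ℤ) ≤ ((E.η₀ : ℤ) - 2 * (E.tail 0 : ℤ)) * (n : ℤ) :=
    mul_nonneg (by have := h2a; omega) (by positivity)
  rw [e1, e2, max_eq_right hnn]

/-- Hence `M_j` is the natural number `μ(η_{3+j}) · n`. -/
theorem faceMZ_toNat (n : ℕ) (j : Fin (M + 2)) : (E.faceMZ n j).toNat = E.mu (E.tail j) * n := by
  rw [faceMZ_eq, Int.toNat_natCast]

/-- Zudilin's arithmetic factor `Φ(h_n)` [(8.9)] VERBATIM at the ray: `PhiQ` with heads `1,1,1`, the `M + 2` tail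
bricks, `k_lo = h₄` and prime range `√h₀ < p ≤ M_{q−3}` (for `M = 2` this is the tree's `Phi`, `PhiQ_four`). -/
def facePhi (n : ℕ) : ℕ := PhiQ (E.h0 n) 1 1 1 (E.hT n) (E.hT n 0) (E.faceMZ n (Fin.last (M + 1)))

/-- Lemma 19's `D_{M₁}³ · D_{M₂} ⋯ D_{M_{q−3}}` at the ray (`D_N = lcm(1,…,N)` = `Nat.lcmUpto N`; the cube sits on
the largest exponent `M₁`, the one of the smallest tail `η₄`). -/
def faceD (n : ℕ) : ℕ :=
  Nat.lcmUpto (E.faceMZ n 0).toNat ^ 3 * (∏ j : Fin M, Nat.lcmUpto (E.faceMZ n j.succ.castSucc).toNat)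
    * Nat.lcmUpto (E.faceMZ n (Fin.last (M + 1))).toNat

/-- THE NORMALISED FORMS `Λ_n(F) := D(n) · Φ(h_n)⁻¹ · F n` for a real sequence `F` (meant: `F n = F(h_n)` of (8.6);
by Lemma 19 [PRINTED, not used] these lie in `ℤ + ℤζ(5) + ℤζ(7) + ⋯`). -/
def faceLambda (F : ℕ → ℝ) (n : ℕ) : ℝ := (E.faceD n : ℝ) / (E.facePhi n : ℝ) * F n

/-- `φ⁺_ℕ := Σ_{j : η_j < η_q} (η₀ − 2η_j)`: the pole lengths of the ALIVE bricks (a natural number). -/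
def phiPlusN : ℕ := ∑ j ∈ univ.filter (fun j => E.tail j < E.d), (E.η₀ - 2 * E.tail j)

/-! ### 2. The `Φ` side: `log Φ(h_n) ≤ Σ_alive θ((η₀ − 2η_j) n)` and `φ_true ≤ φ⁺` by the PNT -/

/-- `Φ(h_n) ≥ 1`. -/
theorem facePhi_pos (n : ℕ) : 0 < E.facePhi n := by
  unfold facePhi PhiQ
  exact Finset.prod_pos fun p hp => pow_pos (Finset.mem_filter.1 hp).2.pos _

/-- `PhiQ_face_le` at the ray, with the dictionary: `Φ(h_n) ≤ ∏_{j : η_j < η_q} ((η₀ − 2η_j)·n)#` (`n ≥ 1`). -/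
theorem facePhi_le_prod (n : ℕ) (hn : 1 ≤ n) :
    E.facePhi n ≤ ∏ j ∈ univ.filter (fun j => E.tail j < E.d), primorial ((E.η₀ - 2 * E.tail j) * n) := by
  have hk : ∀ j, E.hT n j ≤ E.hT n (Fin.last (M + 1)) := fun j => by
    unfold hT
    exact_mod_cast Nat.succ_le_succ (Nat.mul_le_mul_right n (E.hhi j))
  have h2k : 2 * E.hT n (Fin.last (M + 1)) ≤ E.h0 n := by
    have h : 2 * (E.tail (Fin.last (M + 1)) * n) ≤ E.η₀ * n := by
      rw [← Nat.mul_assoc]; exact Nat.mul_le_mul_right n E.hd.le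
    have h' : ((2 * (E.tail (Fin.last (M + 1)) * n) : ℕ) : ℤ) ≤ ((E.η₀ * n : ℕ) : ℤ) := by exact_mod_cast h
    unfold hT h0; push_cast at h' ⊢; linarith
  have hlo : E.hT n 0 ≤ E.hT n (Fin.last (M + 1)) := hk 0
  have hhi : E.hT n (Fin.last (M + 1)) ≤ E.h0 n - E.hT n 0 := by
    have h : E.tail 0 * n + E.tail (Fin.last (M + 1)) * n ≤ E.η₀ * n := by
      rw [← Nat.add_mul]; exact Nat.mul_le_mul_right n E.a_add_d_le
    have h' : ((E.tail 0 * n + E.tail (Fin.last (M + 1)) * n : ℕ) : ℤ) ≤ ((E.η₀ * n : ℕ) : ℤ) := by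
      exact_mod_cast h
    unfold hT h0; push_cast at h' ⊢; linarith
  refine (PhiQ_face_le (E.h0 n) (E.hT n) (E.hT n 0) (E.hT n (Fin.last (M + 1)))
    (E.faceMZ n (Fin.last (M + 1))) hk h2k hlo hhi).trans (le_of_eq ?_)
  rw [Finset.prod_filter]
  refine Finset.prod_congr rfl fun j _ => ?_
  have hiff : E.hT n j < E.hT n (Fin.last (M + 1)) ↔ E.tail j < E.d := by
    unfold hT d
    rw [Nat.cast_lt, Nat.add_lt_add_iff_right]
    exact ⟨fun h => lt_of_mul_lt_mul_right h (Nat.zero_le n), fun h => Nat.mul_lt_mul_of_pos_right h hn⟩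
  have hnat : (E.h0 n - 2 * E.hT n j).toNat = (E.η₀ - 2 * E.tail j) * n := by
    have h2 := E.two_tail_le j
    have e : E.h0 n - 2 * E.hT n j = (((E.η₀ - 2 * E.tail j) * n : ℕ) : ℤ) := by
      unfold h0 hT
      rw [Nat.cast_mul (E.η₀ - 2 * E.tail j), Nat.cast_sub h2]
      push_cast
      ring
    rw [e, Int.toNat_natCast]
  by_cases hj : E.tail j < E.d
  · rw [if_pos (hiff.2 hj), if_pos hj, hnat]
  · rw [if_neg (mt hiff.1 hj), if_neg hj]

/-- **`log Φ(h_n) ≤ Σ_{j : η_j < η_q} θ((η₀ − 2η_j)·n)`** for every `n ≥ 1` (exact; `log N# = θ(N)`,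
Mathlib `Chebyshev.theta_eq_log_primorial`). -/
theorem log_facePhi_le (n : ℕ) (hn : 1 ≤ n) :
    Real.log (E.facePhi n) ≤
      ∑ j ∈ univ.filter (fun j => E.tail j < E.d), Chebyshev.theta ((((E.η₀ - 2 * E.tail j) * n : ℕ)) : ℝ) := by
  have hpos : (0 : ℝ) < E.facePhi n := by exact_mod_cast E.facePhi_pos n
  have h' : (E.facePhi n : ℝ) ≤ ∏ j ∈ univ.filter (fun j => E.tail j < E.d),
      ((primorial ((E.η₀ - 2 * E.tail j) * n) : ℕ) : ℝ) := by exact_mod_cast E.facePhi_le_prod n hn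
  refine (Real.log_le_log hpos h').trans_eq ?_
  rw [Real.log_prod fun j _ => by exact_mod_cast (primorial_pos _).ne']
  exact Finset.sum_congr rfl fun j _ => by rw [Chebyshev.theta_eq_log_primorial, Nat.floor_natCast]

/-- PNT, alive brick by alive brick: `(1/n) Σ_{j : η_j < η_q} θ((η₀ − 2η_j)·n) → φ⁺_ℕ`
(tree theorem `Hata1992.tendsto_theta_mul_div`, i.e. `θ(x) ∼ x`). -/
theorem tendsto_sum_theta_div :
    Tendsto (fun n : ℕ => (∑ j ∈ univ.filter (fun j => E.tail j < E.d),
      Chebyshev.theta ((((E.η₀ - 2 * E.tail j) * n : ℕ)) : ℝ)) / n) atTop (𝓝 (E.phiPlusN : ℝ)) := by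
  simp only [phiPlusN, Nat.cast_sum, Finset.sum_div]
  refine tendsto_finsetSum _ fun j _ => ?_
  have h := Literature.NumberTheory.Irrationality.Hata1992.tendsto_theta_mul_div
    (c := ((E.η₀ - 2 * E.tail j : ℕ) : ℝ)) (Nat.cast_nonneg _)
  refine h.congr fun n => ?_
  rw [Nat.cast_mul]

/-- **`φ_true ≤ φ⁺` in the kernel**: for every `ε > 0`, eventually `log Φ(h_n) ≤ (φ⁺_ℕ + ε)·n`. -/
theorem log_facePhi_eventually_le {ε : ℝ} (hε : 0 < ε) :
    ∀ᶠ n : ℕ in atTop, Real.log (E.facePhi n) ≤ (E.phiPlusN + ε) * n := by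
  have h := (tendsto_order.1 E.tendsto_sum_theta_div).2 (E.phiPlusN + ε) (by linarith)
  filter_upwards [h, eventually_ge_atTop 1] with n hn hn1
  have hnpos : (0 : ℝ) < n := by exact_mod_cast hn1
  have h1 := E.log_facePhi_le n hn1
  rw [div_lt_iff₀ hnpos] at hn
  linarith

/-- `φ⁺_ℕ ≤ φ⁺ = FaceDirM.phiPlus` (the alive bricks are among `η₄, …, η_{q−1}`; dead middle bricks only help). -/
theorem phiPlusN_le : (E.phiPlusN : ℝ) ≤ E.real.phiPlus := by
  have key : ∀ j : Fin (M + 2),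
      (((if E.tail j < E.d then E.η₀ - 2 * E.tail j else 0 : ℕ)) : ℝ) ≤ (E.η₀ : ℝ) - 2 * (E.tail j : ℝ) := by
    intro j
    have h2 := E.two_tail_le j
    have h2' : (2 : ℝ) * (E.tail j : ℝ) ≤ E.η₀ := by exact_mod_cast h2
    split_ifs
    · rw [Nat.cast_sub h2]; push_cast; exact le_rfl
    · push_cast; linarith
  have hlast : ¬ (E.tail (Fin.last (M + 1)) < E.d) := lt_irrefl _
  unfold phiPlusN
  rw [Finset.sum_filter, Nat.cast_sum, Fin.sum_univ_castSucc, Fin.sum_univ_succ, if_neg hlast]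
  simp only [FaceDirM.phiPlus, real, a, mid, d, Fin.castSucc_zero, Nat.cast_zero, add_zero]
  exact add_le_add (key 0) (Finset.sum_le_sum fun j _ => key _)

/-! ### 3. The `D` side: `(1/n) log (D_{M₁}³ D_{M₂} ⋯ D_{M_{q−3}}) → δ` by the PNT -/

/-- `D(n) ≥ 1`. -/
theorem faceD_pos (n : ℕ) : 0 < E.faceD n := by
  unfold faceD
  exact Nat.mul_pos (Nat.mul_pos (pow_pos (Nat.lcmUpto_pos _) 3)
    (Finset.prod_pos fun j _ => Nat.lcmUpto_pos _)) (Nat.lcmUpto_pos _)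

/-- `D(n)` through the dictionary: `D_{μ(η₄)n}³ · ∏_mid D_{μ(η_j)n} · D_{μ(η_q)n}`. -/
theorem faceD_eq (n : ℕ) : E.faceD n =
    Nat.lcmUpto (E.mu E.a * n) ^ 3 * (∏ j : Fin M, Nat.lcmUpto (E.mu (E.mid j) * n))
      * Nat.lcmUpto (E.mu E.d * n) := by
  simp only [faceD, faceMZ_toNat]
  rfl

/-- `log D(n) = 3 log D_{μ(η₄)n} + Σ_mid log D_{μ(η_j)n} + log D_{μ(η_q)n}`. -/
theorem log_faceD_eq (n : ℕ) : Real.log (E.faceD n) =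
    3 * Real.log (Nat.lcmUpto (E.mu E.a * n)) + ∑ j : Fin M, Real.log (Nat.lcmUpto (E.mu (E.mid j) * n))
      + Real.log (Nat.lcmUpto (E.mu E.d * n)) := by
  have hne : ∀ k, (Nat.lcmUpto k : ℝ) ≠ 0 := fun k => by exact_mod_cast (Nat.lcmUpto_pos k).ne'
  rw [E.faceD_eq]
  push_cast
  rw [Real.log_mul (mul_ne_zero (pow_ne_zero _ (hne _)) (Finset.prod_ne_zero_iff.2 fun j _ => hne _)) (hne _),
    Real.log_mul (pow_ne_zero _ (hne _)) (Finset.prod_ne_zero_iff.2 fun j _ => hne _), Real.log_pow,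
    Real.log_prod fun j _ => hne _]
  push_cast
  ring

/-- The cast `μ(x) = FaceDirM.mOf x` of the real structure (`x ≤ η₀`). -/
theorem mu_cast {x : ℕ} (hx : x ≤ E.η₀) : ((E.mu x : ℕ) : ℝ) = E.real.mOf x := by
  have h2a : 2 * E.a ≤ E.η₀ := E.two_tail_le 0
  have h2a' : (2 : ℝ) * (E.a : ℝ) ≤ E.η₀ := by exact_mod_cast h2a
  unfold mu FaceDirM.mOf; simp only [real]
  rw [Nat.cast_max, Nat.cast_sub h2a, Nat.cast_sub hx]
  push_cast
  rw [max_eq_right (sub_nonneg.2 h2a')]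

/-- **`(log D(n))/n → δ = FaceDirM.delta`** (PNT for `ψ`, factor by factor: the tree's
`ViolaZudilin.tendsto_log_lcmUpto_mul_div`). -/
theorem tendsto_log_faceD_div : Tendsto (fun n : ℕ => Real.log (E.faceD n) / n) atTop (𝓝 E.real.delta) := by
  have ha := tendsto_log_lcmUpto_mul_div (E.mu_pos E.a)
  have hd := tendsto_log_lcmUpto_mul_div (E.mu_pos E.d)
  have hmid : Tendsto (fun n : ℕ => (∑ j : Fin M, Real.log (Nat.lcmUpto (E.mu (E.mid j) * n))) / n) atTop
      (𝓝 (∑ j : Fin M, ((E.mu (E.mid j) : ℕ) : ℝ))) := by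
    simp only [Finset.sum_div]
    exact tendsto_finsetSum _ fun j _ => tendsto_log_lcmUpto_mul_div (E.mu_pos _)
  have hlim : Tendsto (fun n : ℕ => Real.log (E.faceD n) / n) atTop
      (𝓝 (3 * ((E.mu E.a : ℕ) : ℝ) + ∑ j : Fin M, ((E.mu (E.mid j) : ℕ) : ℝ) + ((E.mu E.d : ℕ) : ℝ))) := by
    have h := ((ha.const_mul 3).add hmid).add hd
    refine h.congr fun n => ?_
    rw [E.log_faceD_eq]
    ring
  have e1 : ((E.mu E.a : ℕ) : ℝ) = E.real.mOf E.real.a := E.mu_cast (E.tail_lt_η₀ 0).le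
  have e2 : ∀ j, ((E.mu (E.mid j) : ℕ) : ℝ) = E.real.mOf (E.real.mid j) := fun j => E.mu_cast (E.tail_lt_η₀ _).le
  have e3 : ((E.mu E.d : ℕ) : ℝ) = E.real.mOf E.real.d := E.mu_cast (E.tail_lt_η₀ _).le
  have hδ : E.real.delta =
      3 * ((E.mu E.a : ℕ) : ℝ) + ∑ j : Fin M, ((E.mu (E.mid j) : ℕ) : ℝ) + ((E.mu E.d : ℕ) : ℝ) := by
    rw [FaceDirM.delta, e1, e3, Finset.sum_congr rfl fun j _ => e2 j]
  rw [hδ]; exact hlim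

/-! ### 4. Assembly: the normalised forms grow, given the decay floor -/

/-- `|Λ_n(F)| = D(n)/Φ(h_n) · |F n|`. -/
theorem abs_faceLambda (F : ℕ → ℝ) (n : ℕ) :
    |E.faceLambda F n| = (E.faceD n : ℝ) / (E.facePhi n : ℝ) * |F n| := by
  unfold faceLambda
  rw [abs_mul, abs_of_pos (div_pos (by exact_mod_cast E.faceD_pos n) (by exact_mod_cast E.facePhi_pos n))]

/-- **GROWTH GIVEN THE DECAY FLOOR (every `M`).** If `|F n| ≥ exp(−(C₀ + ε) n)` eventually for every `ε > 0`
(`C₀ = FaceDirM.C0`, the boundary-lemma rate), then for every `ε > 0`, eventually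
`exp((δ − φ⁺ − C₀ − ε)·n) ≤ |Λ_n(F)|`. -/
theorem faceLambda_eventually_ge (F : ℕ → ℝ)
    (hF : ∀ ε : ℝ, 0 < ε → ∀ᶠ n : ℕ in atTop, Real.exp (-(E.real.C0 + ε) * n) ≤ |F n|)
    {ε : ℝ} (hε : 0 < ε) :
    ∀ᶠ n : ℕ in atTop,
      Real.exp ((E.real.delta - E.real.phiPlus - E.real.C0 - ε) * n) ≤ |E.faceLambda F n| := by
  have hε3 : 0 < ε / 3 := by positivity
  have hD := (tendsto_order.1 E.tendsto_log_faceD_div).1 (E.real.delta - ε / 3) (by linarith)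
  have hΦ := E.log_facePhi_eventually_le hε3
  have hFe := hF (ε / 3) hε3
  filter_upwards [hD, hΦ, hFe, eventually_ge_atTop 1] with n hDn hΦn hFn hn1
  have hnpos : (0 : ℝ) < n := by exact_mod_cast hn1
  have hDpos : (0 : ℝ) < E.faceD n := by exact_mod_cast E.faceD_pos n
  have hΦpos : (0 : ℝ) < E.facePhi n := by exact_mod_cast E.facePhi_pos n
  have hFpos : 0 < |F n| := lt_of_lt_of_le (Real.exp_pos _) hFn
  rw [E.abs_faceLambda]
  rw [← Real.log_le_log_iff (Real.exp_pos _) (by positivity), Real.log_exp,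
    Real.log_mul (div_pos hDpos hΦpos).ne' hFpos.ne', Real.log_div hDpos.ne' hΦpos.ne']
  have h1 : (E.real.delta - ε / 3) * n < Real.log (E.faceD n) := by rwa [lt_div_iff₀ hnpos] at hDn
  have h2 : -(E.real.C0 + ε / 3) * n ≤ Real.log |F n| := by
    rw [← Real.log_exp (-(E.real.C0 + ε / 3) * n)]
    exact Real.log_le_log (Real.exp_pos _) hFn
  have h3 : (E.phiPlusN : ℝ) * n ≤ E.real.phiPlus * n := mul_le_mul_of_nonneg_right E.phiPlusN_le hnpos.le
  nlinarith

/-- **THE FACE THEOREM, END TO END MODULO THE DECAY FLOOR (`M ≤ 4`, i.e. `q ≤ 9`: windows `{ζ(5)}`,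
`{ζ(5), ζ(7)}`).** Under the same hypothesis, `|Λ_n(F)| → +∞`: the exponent `δ − φ⁺ − C₀` is
`≥ (2 − log 2 − M log(4/3))·η₀ > 0` (`FaceDirM.face_gap`, `gapConst_pos`).  With `F n = F(h_n)` of (8.6) and
Lemma 19 [PRINTED] the `Λ_n` are Zudilin's integer-normalised linear forms on the face: they do not tend to `0`,
so Proposition 5 never applies there, at any height. -/
theorem faceLambda_tendsto_atTop (hM : M ≤ 4) (F : ℕ → ℝ)
    (hF : ∀ ε : ℝ, 0 < ε → ∀ᶠ n : ℕ in atTop, Real.exp (-(E.real.C0 + ε) * n) ≤ |F n|) :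
    Tendsto (fun n : ℕ => |E.faceLambda F n|) atTop atTop := by
  have hgap := E.real.face_gap
  have hg : 0 < gapConst M * E.real.η₀ := mul_pos (gapConst_pos hM) E.real.η₀_pos
  have hpos : 0 < E.real.delta - E.real.phiPlus - E.real.C0 := by linarith
  have hev := E.faceLambda_eventually_ge F hF (half_pos hpos)
  have hexp : Tendsto (fun n : ℕ => Real.exp ((E.real.delta - E.real.phiPlus - E.real.C0
      - (E.real.delta - E.real.phiPlus - E.real.C0) / 2) * n)) atTop atTop :=
    Real.tendsto_exp_atTop.comp (tendsto_natCast_atTop_atTop.const_mul_atTop (by linarith))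
  exact tendsto_atTop_mono' atTop hev hexp

/-! ### 5. Kernel instance: the MODEL maximiser shape of the `q = 9` face -/

/-- `(93; 0,0,0, 22,25,28,31,34,37)`: the integral shape of `FaceDirM.modelFace9`. -/
def modelFace9Int : IntFaceDir 4 where
  η₀ := 93
  tail := ![22, 25, 28, 31, 34, 37]
  hlo := by decide
  hhi := by decide
  hd := by decide

/-- `φ⁺_ℕ = 49 + 43 + 37 + 31 + 25 = 185` (the five alive bricks). -/
example : modelFace9Int.phiPlusN = 185 := by decide

/-- `δ = 3·μ(22) + μ(25) + μ(28) + μ(31) + μ(34) + μ(37) = 3·71 + 68 + 65 + 62 + 59 + 56 = 523`. -/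
example : 3 * modelFace9Int.mu modelFace9Int.a + ∑ j, modelFace9Int.mu (modelFace9Int.mid j)
    + modelFace9Int.mu modelFace9Int.d = 523 := by decide

/-- At `n = 1` the ray point is `h = (95; 1,1,1, 23,26,29,32,35,38)` (the instance of `WellPoisedFaceAliveBricks`)
and `M₁ = 71`, `M₆ = 56`. -/
example : modelFace9Int.h0 1 = 95 ∧ modelFace9Int.hT 1 0 = 23 ∧ modelFace9Int.faceMZ 1 0 = 71
    ∧ modelFace9Int.faceMZ 1 (Fin.last 5) = 56 := by decide

end IntFaceDir

end WellPoisedFace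

end Summit.KontsevichZagierPeriods.Zeta5Search
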